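import Mathlib
import Summits.PneNP.PneNP.Theorems.CnfIdealGenLengthRankDefectRepresentationsCutLemmaMaxCut

/-!
# Crux `RankDefectRepresentations` (stmt-PneNP-18923), line `rank-dehn-ladder`: ONE-SIDED DECOMPOSITION, COLUMN AND ROW
# VERSIONS WITH THE JOINT ERROR BOUND (lead g16 RESHAPE 15, tool stub W18 `stub_oneSidedPair`; briefs
# `Cruxes/RankDefectRepresentations/Lines/rank-dehn-ladder-briefs-g16c.md` §W18)

Setting (as in W11 `…OneSidedSlack`, p713742, and g7's `…CutLemmaMaxCut`, p642504): a matrix `R : Matrix ι ι' K` over a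
field whose rows and columns are coloured (`row : ι → Q`, `col : ι' → Q`), a colour set `B : Finset Q`, the blocks
`Q = R|_{(row∈B)×(col∉B)}`, `S = R|_{(row∉B)×(col∈B)}`, `P = R|_{(row∈B)×(col∈B)}`, and the bipartition cut
`μ(X) = rank R|_{X×Xᶜ} + rank R|_{Xᶜ×X}`.

W11 proves `rank (P − P'') ≤ 2·rank Q + rank S + Σ_{i∈B} δ i` for a colour-block-diagonal `P''`, from the slack hypothesis
`μ(B ∖ i) ≤ μ(B) + δ i` (`i ∈ B`).  Inside that proof the structure is finer: `P − P'' = Q·Z + E` with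
`rank E ≤ Σ_i a_i`, where `a_i := rank (P'_i − Q'_i Z_i)` is the error of the column-space lift of the colour-`i` column
strip `P'_i` of `P` through the columns of `Q'_i := Q` with the rows of colour `i` removed, and the lift gives
`a_i + rank Q'_i ≤ rank (first block of the cut B ∖ i)` (`column_half` below: W11's construction, with the per-colour
quantities `a_i` exported instead of being spent).  The MIRROR-IMAGE ROW CONSTRUCTION (`column_half` applied to the transposed
instance `Rᵀ, col, row` and transposed back) gives `P − Pr = Zr·S + E'` with `rank E' ≤ Σ_i a'_i` and
`a'_i + rank S_{−i} ≤ rank (second block of the cut B ∖ i)`, `S_{−i} := S` with the columns of colour `i` removed.  ADDING the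
two lift inequalities per colour and using the slack hypothesis gives the JOINT per-colour bound
`a_i + a'_i ≤ (rank Q − rank Q'_i) + (rank S − rank S_{−i}) + δ i` (g7's accounting identity), and summing over `i ∈ B`
with the private-dimension counts `Σ_i (rank Q − rank Q'_i) ≤ rank Q`, `Σ_i (rank S − rank S_{−i}) ≤ rank S`
(`sum_rank_sub_erase_le`) yields `rank E + rank E' ≤ rank Q + rank S + Σ_{i∈B} δ i` (`oneSided_pair`; the registered
signature verbatim is `stub_oneSidedPair`).  This is the input of the SHARP local cut inequality (W19) and of the sharp
average-cut decomposition `mc ≤ 2·E_B μ(B)` (W20).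
HONEST FRAMING: elementary linear algebra, a negative-lane tool of the line; the crux stays open; P ≠ NP is not moved; F-N2 is
a FRONTIER formal rung.
-/

set_option linter.dupNamespace false -- `Summit.PneNP.PneNP.…`: summit = sub-problem name (D-0017)

namespace Summit.PneNP.PneNP.Theorems.CnfIdealGenLengthRankDefectRepresentationsOneSidedPair

open Finset Matrix Module
open Literature.Computability.AlgebraicComplexity (rank_add_le)
open Summit.PneNP.PneNP.Theorems.CnfIdealGenLengthRankDefectRepresentationsCutLemmaMaxCut
  (rank_finsetSum_le exists_lift sum_rank_sub_erase_le)

variable {K : Type} [Field K]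
variable {ι ι' Q : Type} [Fintype ι] [Fintype ι'] [DecidableEq ι] [DecidableEq ι'] [DecidableEq Q]

omit [DecidableEq ι] in
/-- **Column half of the one-sided decomposition, with the per-colour lift errors exported.**  For every colouring
`row, col`, matrix `R` and colour set `B` there are a colour-block-diagonal `Pc` (supported on `{row = col ∈ B}`), a
coefficient matrix `Z`, an error matrix `E` and per-colour errors `a : Q → ℕ` with
`R|_{(row∈B)×(col∈B)} − Pc = R|_{(row∈B)×(col∉B)} · Z + E`, `rank E ≤ Σ_{i∈B} a i`, and for every `i ∈ B`
`a i + rank R|_{(row∈B∖i)×(col∉B)} ≤ rank R|_{(row∈B∖i)×(col∉(B∖i))}` (the column-space lift of the colour-`i` column strip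
through the columns of `Q` with the rows of colour `i` removed).  W11's / p642504's construction verbatim. [folklore] -/
theorem column_half (row : ι → Q) (col : ι' → Q) (R : Matrix ι ι' K) (B : Finset Q) :
    ∃ (Pc E : Matrix ι ι' K) (Z : Matrix ι' ι' K) (a : Q → ℕ),
      (∀ x y, ¬ (row x = col y ∧ col y ∈ B) → Pc x y = 0) ∧
      (Matrix.of fun x y => if row x ∈ B ∧ col y ∈ B then R x y else 0) - Pc =
        (Matrix.of fun x y => if row x ∈ B ∧ col y ∉ B then R x y else 0) * Z + E ∧
      E.rank ≤ ∑ i ∈ B, a i ∧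
      ∀ i ∈ B, a i + (Matrix.of fun x y => if row x ∈ B.erase i ∧ col y ∉ B then R x y else 0).rank ≤
        (Matrix.of fun x y => if row x ∈ B.erase i ∧ col y ∉ B.erase i then R x y else 0).rank := by
  classical
  -- names
  set Qm : Matrix ι ι' K := Matrix.of fun x y => if row x ∈ B ∧ col y ∉ B then R x y else 0 with hQm
  set Pm : Matrix ι ι' K := Matrix.of fun x y => if row x ∈ B ∧ col y ∈ B then R x y else 0 with hPm
  -- for each colour `i ∈ B`: the partial blocks and the lift
  set Q' : Q → Matrix ι ι' K := fun i => Matrix.of fun x y => if row x ∈ B.erase i ∧ col y ∉ B then R x y else 0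
    with hQ'
  set P' : Q → Matrix ι ι' K := fun i => Matrix.of fun x y => if row x ∈ B.erase i ∧ col y = i then R x y else 0
    with hP'
  have hlift : ∀ i, i ∈ B → ∃ Z : Matrix ι' ι' K, (P' i - Q' i * Z).rank + (Q' i).rank ≤ (Q' i + P' i).rank := by
    intro i hi
    refine exists_lift (Q' i) (P' i) (fun y => col y ∉ B) (fun x y hy => ?_) (fun x y hy => ?_)
    · simp only [hQ', Matrix.of_apply]; rw [if_neg]; exact fun h => hy h.2
    · simp only [hP', Matrix.of_apply]; rw [if_neg]; rintro ⟨-, h⟩; exact hy (h ▸ hi)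
  choose! Z hZ using hlift
  -- restrict `Z i` to the columns of colour `i`
  set Δ : Q → Matrix ι' ι' K := fun i => Matrix.diagonal fun y => if col y = i then (1 : K) else 0 with hΔ
  set Zf : Q → Matrix ι' ι' K := fun i => Z i * Δ i with hZf
  set E : Q → Matrix ι ι' K := fun i => P' i - Q' i * Zf i with hEd
  -- entrywise facts
  have mulΔ : ∀ (A : Matrix ι ι' K) i x y, (A * Δ i) x y = if col y = i then A x y else 0 := by
    intro A i x y
    simp only [hΔ, Matrix.mul_diagonal]
    split_ifs <;> simp
  have fact1 : ∀ i x y, col y ≠ i → (Qm * Zf i) x y = 0 := by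
    intro i x y h
    simp only [hZf, ← Matrix.mul_assoc, mulΔ, if_neg h]
  have fact2 : ∀ (W : Matrix ι' ι' K) x y, row x ∉ B → (Qm * W) x y = 0 := by
    intro W x y hx
    simp only [Matrix.mul_apply, hQm, Matrix.of_apply]
    exact Finset.sum_eq_zero fun y' _ => by rw [if_neg (fun h => hx h.1), zero_mul]
  have fact3 : ∀ i (W : Matrix ι' ι' K) x y, (Q' i * W) x y = if row x ∈ B.erase i then (Qm * W) x y else 0 := by
    intro i W x y
    simp only [Matrix.mul_apply, hQ', hQm, Matrix.of_apply]
    by_cases hx : row x ∈ B.erase i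
    · rw [if_pos hx]
      refine Finset.sum_congr rfl fun y' _ => ?_
      have hxB : row x ∈ B := (mem_erase.mp hx).2
      by_cases hy' : col y' ∉ B
      · rw [if_pos ⟨hx, hy'⟩, if_pos ⟨hxB, hy'⟩]
      · rw [if_neg (fun h => hy' h.2), if_neg (fun h => hy' h.2)]
    · rw [if_neg hx]
      exact Finset.sum_eq_zero fun y' _ => by rw [if_neg (fun h => hx h.1), zero_mul]
  have hErank : ∀ i ∈ B, (E i).rank ≤ (P' i - Q' i * Z i).rank := by
    intro i hi
    have : E i = (P' i - Q' i * Z i) * Δ i := by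
      ext x y
      simp only [hEd, hZf, Matrix.sub_apply, ← Matrix.mul_assoc, mulΔ]
      by_cases hy : col y = i
      · simp [hy]
      · rw [if_neg hy, if_neg hy, sub_zero]
        simp only [hP', Matrix.of_apply]; rw [if_neg]; rintro ⟨-, h⟩; exact hy h
    rw [this]; exact Matrix.rank_mul_le_left _ _
  -- `Q' i + P' i` is the first block of the cut `B.erase i`
  have e1 : ∀ i ∈ B, Q' i + P' i = Matrix.of fun x y => if row x ∈ B.erase i ∧ col y ∉ B.erase i then R x y else 0 := by
    intro i hi
    ext x y
    simp only [hQ', hP', Matrix.add_apply, Matrix.of_apply]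
    have hmem : col y ∉ B.erase i ↔ (col y ∉ B ∨ col y = i) := by
      rw [mem_erase, not_and_or, not_not]; tauto
    by_cases hr : row x ∈ B.erase i
    · by_cases h1 : col y ∈ B
      · by_cases h2 : col y = i
        · rw [if_neg (fun h => h.2 h1), if_pos ⟨hr, h2⟩, if_pos ⟨hr, hmem.mpr (Or.inr h2)⟩, zero_add]
        · rw [if_neg (fun h => h.2 h1), if_neg (fun h => h2 h.2),
            if_neg (fun h => (hmem.mp h.2).elim (fun h' => h' h1) h2), add_zero]
      · have h2 : col y ≠ i := fun h => h1 (h ▸ hi)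
        rw [if_pos ⟨hr, h1⟩, if_neg (fun h => h2 h.2), if_pos ⟨hr, hmem.mpr (Or.inl h1)⟩, add_zero]
    · rw [if_neg (fun h => hr h.1), if_neg (fun h => hr h.1), if_neg (fun h => hr h.1), add_zero]
  -- the colour-block-diagonal approximant
  set P'' : Matrix ι ι' K := Matrix.of fun x y =>
    if row x = col y ∧ col y ∈ B then R x y - (Qm * Zf (col y)) x y else 0 with hP''
  have hdec : Pm - P'' = Qm * (∑ i ∈ B, Zf i) + ∑ i ∈ B, E i := by
    ext x y
    have s1 : (Qm * ∑ i ∈ B, Zf i) x y = if col y ∈ B then (Qm * Zf (col y)) x y else 0 := by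
      rw [Matrix.mul_sum, Matrix.sum_apply]
      by_cases hyB : col y ∈ B
      · rw [if_pos hyB, Finset.sum_eq_single_of_mem (col y) hyB (fun i _ hi => fact1 i x y (Ne.symm hi))]
      · rw [if_neg hyB]; exact Finset.sum_eq_zero (fun i hi => fact1 i x y (fun h => hyB (h ▸ hi)))
    have s2 : ∀ i, E i x y = (if row x ∈ B.erase i ∧ col y = i then R x y else 0) -
        (if row x ∈ B.erase i then (Qm * Zf i) x y else 0) := by
      intro i; simp only [hEd, Matrix.sub_apply, hP', Matrix.of_apply, fact3]
    have s2' : ∀ i, col y ≠ i → E i x y = 0 := by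
      intro i hne
      rw [s2, fact1 i x y hne, if_neg (show ¬ (row x ∈ B.erase i ∧ col y = i) from fun h => hne h.2)]
      split_ifs <;> simp
    have s3 : (∑ i ∈ B, E i) x y = if col y ∈ B then E (col y) x y else 0 := by
      rw [Matrix.sum_apply]
      by_cases hyB : col y ∈ B
      · rw [if_pos hyB, Finset.sum_eq_single_of_mem (col y) hyB (fun i _ hi => s2' i (Ne.symm hi))]
      · rw [if_neg hyB]; exact Finset.sum_eq_zero (fun i hi => s2' i (fun h => hyB (h ▸ hi)))
    rw [Matrix.add_apply, s1, s3, Matrix.sub_apply]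
    by_cases hyB : col y ∈ B
    · rw [if_pos hyB, if_pos hyB, s2]
      by_cases hxB : row x ∈ B
      · by_cases hxi : row x = col y
        · have hne : row x ∉ B.erase (col y) := by simp [hxi]
          have vPm : Pm x y = R x y := by simp [hPm, hxB, hyB]
          have vP : P'' x y = R x y - (Qm * Zf (col y)) x y := by simp [hP'', hxi, hyB]
          have v3 : (if row x ∈ B.erase (col y) ∧ col y = col y then R x y else 0) = 0 := by simp [hne]
          have v4 : (if row x ∈ B.erase (col y) then (Qm * Zf (col y)) x y else 0) = 0 := by simp [hne]
          rw [vPm, vP, v3, v4]; ring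
        · have hmem : row x ∈ B.erase (col y) := mem_erase.mpr ⟨hxi, hxB⟩
          have vPm : Pm x y = R x y := by simp [hPm, hxB, hyB]
          have vP : P'' x y = 0 := by simp [hP'', hxi]
          have v3 : (if row x ∈ B.erase (col y) ∧ col y = col y then R x y else 0) = R x y := by simp [hmem]
          have v4 : (if row x ∈ B.erase (col y) then (Qm * Zf (col y)) x y else 0) = (Qm * Zf (col y)) x y := by
            simp [hmem]
          rw [vPm, vP, v3, v4]; ring
      · have hne : row x ∉ B.erase (col y) := fun h => hxB (mem_erase.mp h).2
        have hne' : ¬ (row x = col y ∧ col y ∈ B) := fun h => hxB (h.1 ▸ hyB)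
        have vPm : Pm x y = 0 := by simp [hPm, hxB]
        have vP : P'' x y = 0 := by simp [hP'', hne']
        have v3 : (if row x ∈ B.erase (col y) ∧ col y = col y then R x y else 0) = 0 := by simp [hne]
        have v4 : (if row x ∈ B.erase (col y) then (Qm * Zf (col y)) x y else 0) = 0 := by simp [hne]
        rw [vPm, vP, v3, v4, fact2 _ x y hxB]; ring
    · rw [if_neg hyB, if_neg hyB]
      have vPm : Pm x y = 0 := by simp [hPm, hyB]
      have vP : P'' x y = 0 := by simp [hP'', hyB]
      rw [vPm, vP]; ring
  refine ⟨P'', ∑ i ∈ B, E i, ∑ i ∈ B, Zf i, fun i => (P' i - Q' i * Z i).rank,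
    fun x y hxy => by simp only [hP'', Matrix.of_apply, if_neg hxy], hdec,
    (rank_finsetSum_le B E).trans (Finset.sum_le_sum hErank), fun i hi => ?_⟩
  have hl := hZ i hi
  rw [e1 i hi] at hl
  exact hl

/-- **One-sided decomposition, column and row versions with the joint error bound.**  If for every colour `i ∈ B` the
bipartition cut of `B ∖ {i}` is at most the bipartition cut of `B` plus a (signed) slack `δ i`, then there are
colour-block-diagonal matrices `Pc, Pr` (supported on `{row = col ∈ B}`), coefficient matrices `Z, Zr` and error matrices
`E, E'` with `P − Pc = Q·Z + E`, `P − Pr = Zr·S + E'` and `rank E + rank E' ≤ rank Q + rank S + Σ_{i∈B} δ i`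
(`P, Q, S` the blocks `R|_{(row∈B)×(col∈B)}`, `R|_{(row∈B)×(col∉B)}`, `R|_{(row∉B)×(col∈B)}`).  Both halves of g7's
accounting identity `a_i + a'_i ≤ (μ(B∖i) − μ(B)) + q_i + s_i`: the column half is `column_half`, the row half is
`column_half` for the transposed instance, and the private dimensions `q_i`, `s_i` add up below `rank Q`, `rank S`.
[folklore] -/
theorem oneSided_pair (row : ι → Q) (col : ι' → Q) (R : Matrix ι ι' K) (B : Finset Q) (δ : Q → ℤ)
    (h : ∀ i ∈ B,
      (((Matrix.of fun x y => if row x ∈ B.erase i ∧ col y ∉ B.erase i then R x y else 0).rank : ℤ) +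
        ((Matrix.of fun x y => if row x ∉ B.erase i ∧ col y ∈ B.erase i then R x y else 0).rank : ℤ)) ≤
      ((Matrix.of fun x y => if row x ∈ B ∧ col y ∉ B then R x y else 0).rank : ℤ) +
        ((Matrix.of fun x y => if row x ∉ B ∧ col y ∈ B then R x y else 0).rank : ℤ) + δ i) :
    ∃ (Pc Pr E E' : Matrix ι ι' K) (Z : Matrix ι' ι' K) (Zr : Matrix ι ι K),
      (∀ x y, ¬ (row x = col y ∧ col y ∈ B) → Pc x y = 0) ∧
      (∀ x y, ¬ (row x = col y ∧ col y ∈ B) → Pr x y = 0) ∧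
      (Matrix.of fun x y => if row x ∈ B ∧ col y ∈ B then R x y else 0) - Pc =
        (Matrix.of fun x y => if row x ∈ B ∧ col y ∉ B then R x y else 0) * Z + E ∧
      (Matrix.of fun x y => if row x ∈ B ∧ col y ∈ B then R x y else 0) - Pr =
        Zr * (Matrix.of fun x y => if row x ∉ B ∧ col y ∈ B then R x y else 0) + E' ∧
      (E.rank : ℤ) + (E'.rank : ℤ) ≤
        ((Matrix.of fun x y => if row x ∈ B ∧ col y ∉ B then R x y else 0).rank : ℤ) +
          ((Matrix.of fun x y => if row x ∉ B ∧ col y ∈ B then R x y else 0).rank : ℤ) + ∑ i ∈ B, δ i := by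
  classical
  -- the column half
  obtain ⟨Pc, E, Z, a, hPc, hdec, hE, ha⟩ := column_half row col R B
  -- the row half = the column half of the transposed instance `Rᵀ, col, row`
  obtain ⟨Pc', E', Z', a', hPc', hdec', hE', ha'⟩ := column_half (K := K) col row Rᵀ B
  -- transposition dictionary
  have tP : (Matrix.of fun (y : ι') (x : ι) => if col y ∈ B ∧ row x ∈ B then Rᵀ y x else (0 : K))ᵀ =
      Matrix.of fun x y => if row x ∈ B ∧ col y ∈ B then R x y else 0 := by
    ext x y
    simp only [Matrix.transpose_apply, Matrix.of_apply]
    split_ifs <;> tauto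
  have tS : (Matrix.of fun (y : ι') (x : ι) => if col y ∈ B ∧ row x ∉ B then Rᵀ y x else (0 : K))ᵀ =
      Matrix.of fun x y => if row x ∉ B ∧ col y ∈ B then R x y else 0 := by
    ext x y
    simp only [Matrix.transpose_apply, Matrix.of_apply]
    split_ifs <;> tauto
  have tSi : ∀ i, (Matrix.of fun (y : ι') (x : ι) => if col y ∈ B.erase i ∧ row x ∉ B then Rᵀ y x else (0 : K)) =
      (Matrix.of fun x y => if row x ∉ B ∧ col y ∈ B.erase i then R x y else (0 : K))ᵀ := by
    intro i
    ext y x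
    simp only [Matrix.transpose_apply, Matrix.of_apply]
    split_ifs <;> tauto
  have tBi : ∀ i,
      (Matrix.of fun (y : ι') (x : ι) => if col y ∈ B.erase i ∧ row x ∉ B.erase i then Rᵀ y x else (0 : K)) =
      (Matrix.of fun x y => if row x ∉ B.erase i ∧ col y ∈ B.erase i then R x y else (0 : K))ᵀ := by
    intro i
    ext y x
    simp only [Matrix.transpose_apply, Matrix.of_apply]
    split_ifs <;> tauto
  -- the row identity, transposed back
  have hdecR : (Matrix.of fun x y => if row x ∈ B ∧ col y ∈ B then R x y else (0 : K)) - Pc'ᵀ =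
      Z'ᵀ * (Matrix.of fun x y => if row x ∉ B ∧ col y ∈ B then R x y else (0 : K)) + E'ᵀ := by
    have t := congrArg Matrix.transpose hdec'
    rw [Matrix.transpose_sub, Matrix.transpose_add, Matrix.transpose_mul, tP, tS] at t
    exact t
  -- private dimensions: rows of `Q` by row colour, columns of `S` by column colour (W11 verbatim)
  have hq : ∑ i ∈ B, (((Matrix.of fun x y => if row x ∈ B ∧ col y ∉ B then R x y else (0 : K)).rank : ℤ) -
      ((Matrix.of fun x y => if row x ∈ B.erase i ∧ col y ∉ B then R x y else (0 : K)).rank : ℤ)) ≤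
      ((Matrix.of fun x y => if row x ∈ B ∧ col y ∉ B then R x y else (0 : K)).rank : ℤ) := by
    have main := sum_rank_sub_erase_le (K := K) row (Matrix.of fun x y => if col y ∉ B then R x y else (0 : K)) B B
    have e0 : ∀ S : Finset Q, (Matrix.of fun z y => if row z ∈ S then
        (Matrix.of fun x y => if col y ∉ B then R x y else (0 : K)) z y else 0) =
        Matrix.of fun x y => if row x ∈ S ∧ col y ∉ B then R x y else 0 := by
      intro S; ext x y; simp only [Matrix.of_apply]; split_ifs <;> tauto
    simp only [e0, Finset.sdiff_self] at main
    have hz : ((Matrix.of fun x y => if row x ∈ (∅ : Finset Q) ∧ col y ∉ B then R x y else (0 : K)).rank : ℤ) ≥ 0 := by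
      positivity
    linarith
  have hs : ∑ i ∈ B, (((Matrix.of fun x y => if row x ∉ B ∧ col y ∈ B then R x y else (0 : K)).rank : ℤ) -
      ((Matrix.of fun x y => if row x ∉ B ∧ col y ∈ B.erase i then R x y else (0 : K)).rank : ℤ)) ≤
      ((Matrix.of fun x y => if row x ∉ B ∧ col y ∈ B then R x y else (0 : K)).rank : ℤ) := by
    have main := sum_rank_sub_erase_le (K := K) col
      (Matrix.of fun (y : ι') (x : ι) => if row x ∉ B then R x y else (0 : K)) B B
    have e0 : ∀ S : Finset Q, (Matrix.of fun (z : ι') (x : ι) => if col z ∈ S then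
        (Matrix.of fun (y : ι') (x : ι) => if row x ∉ B then R x y else (0 : K)) z x else 0) =
        (Matrix.of fun x y => if row x ∉ B ∧ col y ∈ S then R x y else (0 : K)).transpose := by
      intro S; ext y x; simp only [Matrix.of_apply, Matrix.transpose_apply]; split_ifs <;> tauto
    simp only [e0, Matrix.rank_transpose, Finset.sdiff_self] at main
    have hz : ((Matrix.of fun x y => if row x ∉ B ∧ col y ∈ (∅ : Finset Q) then R x y else (0 : K)).rank : ℤ) ≥ 0 := by
      positivity
    linarith
  -- the joint per-colour bound `a_i + a'_i ≤ (rank Q − rank Q'_i) + (rank S − rank S_{−i}) + δ i`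
  have hcls : ∀ i ∈ B, ((a i : ℤ) + (a' i : ℤ)) ≤
      (((Matrix.of fun x y => if row x ∈ B ∧ col y ∉ B then R x y else (0 : K)).rank : ℤ) -
        ((Matrix.of fun x y => if row x ∈ B.erase i ∧ col y ∉ B then R x y else (0 : K)).rank : ℤ)) +
      (((Matrix.of fun x y => if row x ∉ B ∧ col y ∈ B then R x y else (0 : K)).rank : ℤ) -
        ((Matrix.of fun x y => if row x ∉ B ∧ col y ∈ B.erase i then R x y else (0 : K)).rank : ℤ)) + δ i := by
    intro i hi
    have h1 := ha i hi
    have h1z : (a i : ℤ) + ((Matrix.of fun x y => if row x ∈ B.erase i ∧ col y ∉ B then R x y else (0 : K)).rank : ℤ) ≤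
        ((Matrix.of fun x y => if row x ∈ B.erase i ∧ col y ∉ B.erase i then R x y else (0 : K)).rank : ℤ) := by
      exact_mod_cast h1
    have h2 := ha' i hi
    rw [tSi i, tBi i, Matrix.rank_transpose, Matrix.rank_transpose] at h2
    have h2z : (a' i : ℤ) + ((Matrix.of fun x y => if row x ∉ B ∧ col y ∈ B.erase i then R x y else (0 : K)).rank : ℤ) ≤
        ((Matrix.of fun x y => if row x ∉ B.erase i ∧ col y ∈ B.erase i then R x y else (0 : K)).rank : ℤ) := by
      exact_mod_cast h2
    have h3 := h i hi
    linarith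
  have hsum : ∑ i ∈ B, ((a i : ℤ) + (a' i : ℤ)) ≤
      ((Matrix.of fun x y => if row x ∈ B ∧ col y ∉ B then R x y else (0 : K)).rank : ℤ) +
        ((Matrix.of fun x y => if row x ∉ B ∧ col y ∈ B then R x y else (0 : K)).rank : ℤ) + ∑ i ∈ B, δ i := by
    refine (Finset.sum_le_sum hcls).trans ?_
    rw [Finset.sum_add_distrib, Finset.sum_add_distrib]
    linarith
  have hEz : (E.rank : ℤ) ≤ ∑ i ∈ B, (a i : ℤ) := by exact_mod_cast hE
  have hE'z : (E'ᵀ.rank : ℤ) ≤ ∑ i ∈ B, (a' i : ℤ) := by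
    rw [Matrix.rank_transpose]; exact_mod_cast hE'
  refine ⟨Pc, Pc'ᵀ, E, E'ᵀ, Z, Z'ᵀ, hPc, fun x y hxy => ?_, hdec, hdecR, ?_⟩
  · rw [Matrix.transpose_apply]
    exact hPc' y x (fun hh => hxy ⟨hh.1.symm, by rw [hh.1]; exact hh.2⟩)
  · rw [Finset.sum_add_distrib] at hsum
    linarith

/-- **TOOL stub W18 `stub_oneSidedPair` (lead g16 RESHAPE 15), the registered signature verbatim: the ONE-SIDED
DECOMPOSITION, COLUMN AND ROW VERSIONS WITH THE JOINT ERROR BOUND.**  For every field `K`, colourings `row, col` by a type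
`Q` of colours, matrix `R`, colour set `B` and slack function `δ : Q → ℤ` with `μ(B ∖ i) ≤ μ(B) + δ i` for all `i ∈ B`
(`μ` the bipartition cut), the diagonal super-block `P = R|_{(row∈B)×(col∈B)}` admits a column approximation
`P − Pc = Q·Z + E` and a row approximation `P − Pr = Zr·S + E'` by matrices `Pc, Pr` supported on `{row = col ∈ B}`, with
`rank E + rank E' ≤ rank Q + rank S + Σ_{i∈B} δ i` (`Q = R|_{(row∈B)×(col∉B)}`, `S = R|_{(row∉B)×(col∈B)}`).  Immediate from
`oneSided_pair`. -/
theorem stub_oneSidedPair :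
    ∀ (K : Type) [Field K] (ι ι' Q : Type) [Fintype ι] [Fintype ι'] [DecidableEq ι] [DecidableEq ι'] [DecidableEq Q]
      (row : ι → Q) (col : ι' → Q) (R : Matrix ι ι' K) (B : Finset Q) (δ : Q → ℤ),
      (∀ i ∈ B,
        (((Matrix.of fun x y => if row x ∈ B.erase i ∧ col y ∉ B.erase i then R x y else 0).rank : ℤ) +
          ((Matrix.of fun x y => if row x ∉ B.erase i ∧ col y ∈ B.erase i then R x y else 0).rank : ℤ)) ≤
        ((Matrix.of fun x y => if row x ∈ B ∧ col y ∉ B then R x y else 0).rank : ℤ) +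
          ((Matrix.of fun x y => if row x ∉ B ∧ col y ∈ B then R x y else 0).rank : ℤ) + δ i) →
      ∃ (Pc Pr E E' : Matrix ι ι' K) (Z : Matrix ι' ι' K) (Zr : Matrix ι ι K),
        (∀ x y, ¬ (row x = col y ∧ col y ∈ B) → Pc x y = 0) ∧
        (∀ x y, ¬ (row x = col y ∧ col y ∈ B) → Pr x y = 0) ∧
        (Matrix.of fun x y => if row x ∈ B ∧ col y ∈ B then R x y else 0) - Pc =
          (Matrix.of fun x y => if row x ∈ B ∧ col y ∉ B then R x y else 0) * Z + E ∧
        (Matrix.of fun x y => if row x ∈ B ∧ col y ∈ B then R x y else 0) - Pr =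
          Zr * (Matrix.of fun x y => if row x ∉ B ∧ col y ∈ B then R x y else 0) + E' ∧
        (E.rank : ℤ) + (E'.rank : ℤ) ≤
          ((Matrix.of fun x y => if row x ∈ B ∧ col y ∉ B then R x y else 0).rank : ℤ) +
            ((Matrix.of fun x y => if row x ∉ B ∧ col y ∈ B then R x y else 0).rank : ℤ) + ∑ i ∈ B, δ i := by
  intro K _ ι ι' Q _ _ _ _ _ row col R B δ h
  exact oneSided_pair row col R B δ h

end Summit.PneNP.PneNP.Theorems.CnfIdealGenLengthRankDefectRepresentationsOneSidedPair
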